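import Mathlib
import HarnessLib
import Summits.HodgeConjecture.HodgeConjecture.Theorems.WeilTypeLadderResidueLemma

/-!
# WeilTypeLadder · the residue lemma lifted to `ZMod (p ^ e)`

b2b cell `hweil` (packet `run/shared/lean/b2b/hodge-weil/`, report `b2b-hweil-pv3-g50/RECIPROCITY.md` §5, prover 3
generation 50). PURE MODULAR ARITHMETIC; no geometry, no named fact, no `decide` census.

The existence recipes for non-split `K`-Weil cyclic-cover Pryms of level `m = 2q^f`, `4p^e`, `p^e q^f`, … (report
`DP-INFINITY.md` 3.6–3.8, 4.2 of prover 3 generation 49) place rotation letters that are UNITS modulo a prime power `p^e`,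
with prescribed quadratic-residue classes of their reductions modulo `p` and a prescribed (unit) sum modulo `p^e`. At
level `e = 1` this is RESIDUE LEMMA 3.5 (a) (`exists_sq_add_sq_ne_zero_of_seven_le`,
`exists_nonsquare_add_nonsquare_of_seven_le` of `WeilTypeLadderResidueLemma`); the present file is the `e ≥ 1` form used
at the higher levels («lift `ȳ₁` arbitrarily, put `y₂ := t − y₁`»):

* `isUnit_iff_castHom_ne_zero` — `y : ZMod (p^e)` is a unit iff its reduction modulo `p` is non-zero;
* `exists_unit_add_unit_sq_residues` — for a prime `p ≥ 7` and `e ≠ 0`, every unit `t` of `ZMod (p^e)` is `y₁ + y₂`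
  with `y₁, y₂` units whose reductions modulo `p` are NON-ZERO SQUARES;
* `exists_unit_add_unit_nonsquare_residues` — the same with both reductions NON-SQUARES.

HONEST LABEL: bookkeeping (elementary, folklore); 0 rungs; nothing of Markman 2025 / Mostaed 2026 / Perry 2026 is
used; no kit job.
-/

-- every declaration of this problem lives in `Summit.HodgeConjecture.HodgeConjecture.…` (summit = sub-problem)
set_option linter.dupNamespace false

namespace Summit.HodgeConjecture.HodgeConjecture.WeilTypeLadder

/-- A residue class modulo `p ^ e` (`p` prime, `e ≠ 0`) is a unit iff its reduction modulo `p` is non-zero.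
[folklore] -/
theorem isUnit_iff_castHom_ne_zero {p : ℕ} [Fact p.Prime] {e : ℕ} (he : e ≠ 0) (y : ZMod (p ^ e)) :
    IsUnit y ↔ ZMod.castHom (dvd_pow_self p he) (ZMod p) y ≠ 0 := by
  have hp : p.Prime := Fact.out
  obtain ⟨n, rfl⟩ : ∃ n : ℕ, (n : ZMod (p ^ e)) = y := ⟨y.val, ZMod.natCast_zmod_val y⟩
  rw [ZMod.isUnit_iff_coprime, Nat.coprime_pow_right_iff (Nat.pos_of_ne_zero he), Nat.coprime_comm,
    hp.coprime_iff_not_dvd, map_natCast, ne_eq, ZMod.natCast_eq_zero_iff]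

/-- **RESIDUE LEMMA LIFTED, squares**: for a prime `p ≥ 7` and `e ≠ 0`, every unit `t` of `ZMod (p ^ e)` is a sum
`y₁ + y₂` of two units whose reductions modulo `p` are non-zero squares (lift a representation
`t̄ = a² + b²`, `a, b ≠ 0`, of the reduction `t̄`: `y₁` any lift of `a²`, `y₂ := t − y₁`). [folklore] -/
theorem exists_unit_add_unit_sq_residues {p : ℕ} [Fact p.Prime] (hp : 7 ≤ p) {e : ℕ} (he : e ≠ 0)
    {t : ZMod (p ^ e)} (ht : IsUnit t) :
    ∃ y₁ y₂ : ZMod (p ^ e), y₁ + y₂ = t ∧ IsUnit y₁ ∧ IsUnit y₂ ∧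
      (∃ a : ZMod p, a ≠ 0 ∧ ZMod.castHom (dvd_pow_self p he) (ZMod p) y₁ = a ^ 2) ∧
      (∃ b : ZMod p, b ≠ 0 ∧ ZMod.castHom (dvd_pow_self p he) (ZMod p) y₂ = b ^ 2) := by
  set π := ZMod.castHom (dvd_pow_self p he) (ZMod p) with hπ
  have hπt : π t ≠ 0 := (isUnit_iff_castHom_ne_zero he t).mp ht
  obtain ⟨a, b, ha, hb, hab⟩ := exists_sq_add_sq_ne_zero_of_seven_le hp hπt
  obtain ⟨y₁, hy₁⟩ := ZMod.ringHom_surjective π (a ^ 2)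
  have hy₂ : π (t - y₁) = b ^ 2 := by rw [map_sub, hy₁, hab]; ring
  refine ⟨y₁, t - y₁, by ring, ?_, ?_, ⟨a, ha, hy₁⟩, ⟨b, hb, hy₂⟩⟩
  · exact (isUnit_iff_castHom_ne_zero he y₁).mpr (by rw [← hπ, hy₁]; exact pow_ne_zero 2 ha)
  · exact (isUnit_iff_castHom_ne_zero he (t - y₁)).mpr (by rw [← hπ, hy₂]; exact pow_ne_zero 2 hb)

/-- **RESIDUE LEMMA LIFTED, non-squares**: for a prime `p ≥ 7` and `e ≠ 0`, every unit `t` of `ZMod (p ^ e)` is a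
sum `y₁ + y₂` of two units whose reductions modulo `p` are non-squares. [folklore] -/
theorem exists_unit_add_unit_nonsquare_residues {p : ℕ} [Fact p.Prime] (hp : 7 ≤ p) {e : ℕ} (he : e ≠ 0)
    {t : ZMod (p ^ e)} (ht : IsUnit t) :
    ∃ y₁ y₂ : ZMod (p ^ e), y₁ + y₂ = t ∧ IsUnit y₁ ∧ IsUnit y₂ ∧
      ¬IsSquare (ZMod.castHom (dvd_pow_self p he) (ZMod p) y₁) ∧
      ¬IsSquare (ZMod.castHom (dvd_pow_self p he) (ZMod p) y₂) := by
  set π := ZMod.castHom (dvd_pow_self p he) (ZMod p) with hπ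
  have hπt : π t ≠ 0 := (isUnit_iff_castHom_ne_zero he t).mp ht
  obtain ⟨u, v, hu, hv, huv⟩ := exists_nonsquare_add_nonsquare_of_seven_le hp hπt
  obtain ⟨y₁, hy₁⟩ := ZMod.ringHom_surjective π u
  have hy₂ : π (t - y₁) = v := by rw [map_sub, hy₁, huv]; ring
  have hne : ∀ w : ZMod p, ¬IsSquare w → w ≠ 0 := fun w hw h => hw (h ▸ IsSquare.zero)
  refine ⟨y₁, t - y₁, by ring, ?_, ?_, by rwa [hy₁], by rwa [hy₂]⟩
  · exact (isUnit_iff_castHom_ne_zero he y₁).mpr (by rw [← hπ, hy₁]; exact hne u hu)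
  · exact (isUnit_iff_castHom_ne_zero he (t - y₁)).mpr (by rw [← hπ, hy₂]; exact hne v hv)

end Summit.HodgeConjecture.HodgeConjecture.WeilTypeLadder
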